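import Mathlib
import Summits.Ventures.PercRepro2.TypedSpectator

/-!
# The typed `PD`-covariance of `{o ∈ U}` and `{b ∈ U}` (blind cell PercRepro2, night-3 g3, 2026-08-24)

The `PD`-half `T_pd = typedCount pdPart` of row 2′TRI (`typedCount_eq_covPart_sub_pdPart`:
`2N = T_cov − T_pd`) regroups by a spectator copy into two-copy counts on the spectator's minor:

  `T_pd = Σ_x [ 1_PD(x) · pinnedCount G_x z_x (−P4) − (1_Q − 1_PD)(x) · pinnedCount G_x z_x P2 ]`

(`pdPart_eq_sum_spec`, exact), with `P2 ≥ 0` pointwise (`P2_nonneg`), so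
`T_pd ≤ Σ_x 1_PD(x)·pinnedCount G_x z_x (−P4)` (`pdPart_le_sum_spec`). The kernel `−P4` is the
`Q`-RESTRICTED covariance kernel of the two mixed events `pd ∧ {o ∈ U}`, `pd ∧ {b ∈ U}`
(`pd = 1_{Q ∧ a₃ ∉ U}`): `−P4 = pdCovWeak − (1 − 1_Q(w))·f₁₁(y) − (1 − 1_Q(y))·f₁₁(w)`
(`neg_P4_eq`), where **`pdCovWeak`** `= [pd u_o u_b](y) + [pd u_o u_b](w) − [pd u_o](y)[pd u_b](w) −
[pd u_o](w)[pd u_b](y)` is the plain covariance kernel. **`PDCovCount`** names the two-copy statement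
(2′PDCOV) of `NIGHT3-CERT.md` §12.12 for the PLAIN kernel: on every minor `(G, z)`
`pinnedCount G z pdCovWeak ≥ 0`, i.e. `#{y : pd(y), o ∈ U(y), b ∈ U(y)} ≥ #{y : pd(y), o ∈ U(y), pd(ȳ), b ∈ U(ȳ)}`
(`ȳ` the complementary colouring) — census-true on all 153,100,081 two-copy abstract minors with ≤ 8 free
edges (0 violations; 1,169,527 at ≤ 6 (all u), 12,094,027 at 7, 139,836,527 at 8), sharp (false with `pd` on one
copy only). The `Q`-restricted version `pinnedCount G z (−P4) ≥ 0` is FALSE: on the six-edge graph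
`l–o, l–u, h–b, h–u, o–u, b–u` (`a₃` isolated, `u` unmarked) the count is `12 − 13 < 0`; accordingly
`T_pd ≥ 0` fails on 48 of the 69,880,768 abstract instances with six typed edges (there the row is
easier: `2N = T_cov − T_pd > T_cov`). Own code; standard axioms.
-/

namespace Summit.Ventures.PercRepro2

open UnionCluster

namespace CovForm

namespace TypedA3

section PDCov

variable {V : Type*} {E : Type*} [Fintype E] [DecidableEq E] {R : Type*} [Field R]
  [LinearOrder R] [IsStrictOrderedRing R]

omit [Fintype E] [DecidableEq E] [LinearOrder R] [IsStrictOrderedRing R] in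
/-- The plain covariance kernel of `pd ∧ {o ∈ U}` and `pd ∧ {b ∈ U}`:
`[pd u_o u_b](y) + [pd u_o u_b](w) − [pd u_o](y)[pd u_b](w) − [pd u_o](w)[pd u_b](y)`. -/
noncomputable def pdCovWeak (ends : E → Sym2 V) (o a₁ a₂ a₃ b : V) (y w : Config E) : R :=
  f11 ends o a₁ a₂ a₃ b y + f11 ends o a₁ a₂ a₃ b w -
    (f3 ends o a₁ a₂ a₃ y * f12 ends a₁ a₂ a₃ b w + f3 ends o a₁ a₂ a₃ w * f12 ends a₁ a₂ a₃ b y)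

/-- **(2′PDCOV)**: on every minor the typed `PD`-covariance of `{o ∈ U}` and `{b ∈ U}` is
nonnegative — `pinnedCount G z pdCovWeak ≥ 0` (census-true through eight free edges; the
`Q`-restricted kernel `−P4` is NOT nonnegative, see the module docstring). -/
def PDCovCount (ends : E → Sym2 V) (o a₁ a₂ a₃ b : V) : Prop :=
  ∀ (G : Finset E) (z : Config E), 0 ≤ pinnedCount G z (pdCovWeak (R := R) ends o a₁ a₂ a₃ b)

omit [Fintype E] [DecidableEq E] [LinearOrder R] [IsStrictOrderedRing R] in
/-- `−P4` is the plain covariance kernel minus the terms whose complementary copy fails `Q`. -/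
lemma neg_P4_eq (ends : E → Sym2 V) (o a₁ a₂ a₃ b : V) (y w : Config E) :
    -(P4 (R := R) ends o a₁ a₂ a₃ b y w) =
      pdCovWeak ends o a₁ a₂ a₃ b y w - (1 - iQ ends a₁ a₂ w) * f11 ends o a₁ a₂ a₃ b y -
        (1 - iQ ends a₁ a₂ y) * f11 ends o a₁ a₂ a₃ b w := by
  unfold P4 pdCovWeak
  ring

omit [Fintype E] [DecidableEq E] in
/-- `1_PD ≥ 0`. -/
lemma iPD_nonneg (ends : E → Sym2 V) (a₁ a₂ a₃ : V) (x : Config E) :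
    (0 : R) ≤ iPD ends a₁ a₂ a₃ x := by
  unfold iPD
  exact Set.indicator_nonneg (fun _ _ => zero_le_one) x

omit [Fintype E] [DecidableEq E] in
/-- `1_{v ∈ U} ≥ 0`. -/
lemma inU_nonneg (ends : E → Sym2 V) (a₁ a₂ v : V) (x : Config E) :
    (0 : R) ≤ inU ends a₁ a₂ v x := by
  unfold inU iL iH
  exact add_nonneg (Set.indicator_nonneg (fun _ _ => zero_le_one) x)
    (Set.indicator_nonneg (fun _ _ => zero_le_one) x)

omit [Fintype E] [DecidableEq E] in
/-- `P2 ≥ 0` pointwise (a sum of products of indicators). -/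
lemma P2_nonneg (ends : E → Sym2 V) (o a₁ a₂ a₃ b : V) (y w : Config E) :
    (0 : R) ≤ P2 ends o a₁ a₂ a₃ b y w := by
  unfold P2 f12 f3
  have h1 := iPD_nonneg (R := R) ends a₁ a₂ a₃ y
  have h2 := iPD_nonneg (R := R) ends a₁ a₂ a₃ w
  have h3 := inU_nonneg (R := R) ends a₁ a₂ b y
  have h4 := inU_nonneg (R := R) ends a₁ a₂ b w
  have h5 := inU_nonneg (R := R) ends a₁ a₂ o y
  have h6 := inU_nonneg (R := R) ends a₁ a₂ o w
  positivity

omit [LinearOrder R] [IsStrictOrderedRing R] in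
/-- The complementary-pair count is additive under subtraction of kernels. -/
lemma pinnedCount_sub' (G : Finset E) (z : Config E) (K K' : Config E → Config E → R) :
    pinnedCount G z (fun y w => K y w - K' y w) = pinnedCount G z K - pinnedCount G z K' := by
  unfold pinnedCount
  rw [← Finset.sum_sub_distrib]
  refine Finset.sum_congr rfl fun y _ => ?_
  split_ifs <;> simp

/-- The complementary-pair count of `P2` is nonnegative. -/
lemma pinnedCount_P2_nonneg (ends : E → Sym2 V) (o a₁ a₂ a₃ b : V) (G : Finset E)
    (z : Config E) : 0 ≤ pinnedCount G z (P2 (R := R) ends o a₁ a₂ a₃ b) := by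
  unfold pinnedCount
  refine Finset.sum_nonneg fun y _ => ?_
  split_ifs
  · exact P2_nonneg (R := R) ends o a₁ a₂ a₃ b y _
  · exact le_rfl

omit [LinearOrder R] [IsStrictOrderedRing R] in
/-- **`T_pd` regrouped by the spectator copy**: the `PD`-spectators contribute the typed
`PD`-covariance of their minor, the spectators with `a₃ ∈ U` subtract the `P2` mass of theirs. -/
theorem pdPart_eq_sum_spec (ends : E → Sym2 V) (o a₁ a₂ a₃ b : V) (F : Finset E) (z : Config E)
    (τ : E → ℕ) (hτ : ∀ e ∈ F, τ e = 1 ∨ τ e = 2) :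
    typedCount F z τ (pdPart (R := R) ends o a₁ a₂ a₃ b) =
      ∑ x : Config E, if (∀ e, e ∉ F → x e = z e) then
        iPD ends a₁ a₂ a₃ x *
            pinnedCount (specFree F τ x) (specPin F z τ x)
              (fun y w => -(P4 (R := R) ends o a₁ a₂ a₃ b y w)) -
          (iQ ends a₁ a₂ x - iPD ends a₁ a₂ a₃ x) *
            pinnedCount (specFree F τ x) (specPin F z τ x) (P2 ends o a₁ a₂ a₃ b)
      else 0 := by
  rw [typedCount_eq_sum_spec F z τ hτ]
  refine Finset.sum_congr rfl fun x _ => ?_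
  split_ifs
  · rw [← pinnedCount_const_mul, ← pinnedCount_const_mul, ← pinnedCount_sub']
    refine pinnedCount_congr _ _ _ _ fun y w => ?_
    unfold pdPart
    ring
  · rfl

/-- `T_pd` is at most the `PD`-spectators' typed `PD`-covariance mass (the `P2` terms are
subtracted). -/
theorem pdPart_le_sum_spec (ends : E → Sym2 V) (o a₁ a₂ a₃ b : V) (F : Finset E) (z : Config E)
    (τ : E → ℕ) (hτ : ∀ e ∈ F, τ e = 1 ∨ τ e = 2) :
    typedCount F z τ (pdPart (R := R) ends o a₁ a₂ a₃ b) ≤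
      ∑ x : Config E, if (∀ e, e ∉ F → x e = z e) then
        iPD ends a₁ a₂ a₃ x *
          pinnedCount (specFree F τ x) (specPin F z τ x)
            (fun y w => -(P4 (R := R) ends o a₁ a₂ a₃ b y w))
      else 0 := by
  rw [pdPart_eq_sum_spec ends o a₁ a₂ a₃ b F z τ hτ]
  refine Finset.sum_le_sum fun x _ => ?_
  split_ifs
  · have hQ : iPD (R := R) ends a₁ a₂ a₃ x ≤ iQ ends a₁ a₂ x := by
      unfold iPD iQ
      refine Set.indicator_le_indicator_of_subset ?_ (fun _ => zero_le_one) x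
      intro ω hω
      rw [PendantRoot.avoidAll_eq_compl]
      exact hω.1
    have := mul_nonneg (sub_nonneg.2 hQ) (pinnedCount_P2_nonneg (R := R) ends o a₁ a₂ a₃ b
      (specFree F τ x) (specPin F z τ x))
    linarith
  · exact le_rfl

end PDCov

end TypedA3

end CovForm

end Summit.Ventures.PercRepro2
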